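/-
Copyright (c) 2026 the pub-hodgecm-mathlib formalisation cell (harness21).  Prover seat hodgecm-mathlib-K2E5-p16 (g4): Track B «K2-LIT»,
hLiu418 = stmt-HodgeConjecture-24832, ROAD Φ organ Φ6b-4 (B): HOLOMORPHY OF `η(g, h; α₀ + u s, β₀ + v s)` ALONG COMPLEX LINES (both exponents
moving — the diagonal `W(s) = Ξ(y, h; a + s, b + s)` of Road Φ), on `{re(β₀ + v s) > 1}`, for `g, h > 0`; 2026-09-04.
-/
import Summits.HodgeConjecture.HodgeConjecture.Theorems.K2LiuHermTwoEtaHolomorphy               -- ★ p858099 (this seat): the `α`-only case + tools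
import HarnessLib

/-!
# Crux `HLiu418`, ROAD Φ, organ Φ6b-4 (B): `s ↦ η(g, h; α₀ + u s, β₀ + v s)` is holomorphic on `{re(β₀ + v s) > 1}` (`g, h > 0`)
# [Shimura1982, Thm 3.1, the `h > 0` half, Case II, m = κ = 2 — along complex lines in `(α, β)`]

Cell `hodgecm-mathlib`, crux item hLiu418 = `stmt-HodgeConjecture-24832`, route of record `HCCMUnconditional`; squad K2, LEAD F0P6-plan (g12), co-dealer
K2E5-plan (g5), prover K2E5-p16 (g4).  THEOREMS ONLY; lane `--supports stmt-HodgeConjecture-24832 --as helper`.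

WHAT.  ★ `hasDerivAt_etaTwo_alpha` moved `α` alone.  Here BOTH exponents move along a complex line `(α, β) = (α₀ + u s, β₀ + v s)`:
`hasDerivAt_etaTwo_affine` ∕ `differentiableOn_etaTwo_affine` — holomorphy in `s` on the open set `{s | 1 < re(β₀ + v s)}` (where `η` converges),
in particular `differentiableAt_etaTwo_beta` (`β ↦ η(g, h; α, β)` on `re β > 1`) and the DIAGONAL `s ↦ η(g, h; a + s, b + s)`; and
`differentiableOn_xiEta_affine`: the continuation `Ξ(g, h; α, β) = 4π⁴ e^{iπ(β−α)} Γ₂(α)⁻¹ Γ₂(β)⁻¹ η(2g, πh; α, β)` is holomorphic along every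
complex line inside `ℂ × {re β > 1}`.
PROOF.  Differentiation under the integral sign on a ball `|s − s₀| < ε`, `ε = (re(β₀ + v s₀) − 1)/(2(|v| + 1))`; the `s`-derivative of the integrand is
`(u log det(x + h) + v log det(x − h)) ·` integrand; with `p = det(x + h) ≥ det(2h) = δ` and `q = det(x − h) > 0` the majorant uses
`p^{a−2} ≤ max(1, δ^{a₁−a₂}) p^{a₂−2}` (`rpow_le_max_mul_rpow`), `|log p| ≤ (|log δ|/δ + 1) p`, `q^{b−2} ≤ q^{b₁−2} + q^{b₂−2}` and
`|log q| ≤ (q^θ + q^{−θ})/θ` (`θ = (b₁ − 1)/2`): six `η`-integrand norms at real exponents, each integrable by ★ `integrableOn_etaTwoIntegrand_of_posDef`.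
HONEST LABEL.  Count-neutral helper of the K2_Liu road; it pays no socket by itself: `HC_CM` is proved only modulo the 7 printed citations
(2 remaining named inputs: hLiu418 = `stmt-HodgeConjecture-24832`, h413 = `stmt-HodgeConjecture-24833`) until rung 0 closes.
-/

set_option autoImplicit false
-- the mandated namespace repeats the single-problem summit's segment (`HodgeConjecture.HodgeConjecture`)
set_option linter.dupNamespace false

noncomputable section

open Complex MeasureTheory Set
open scoped ComplexOrder ComplexConjugate

namespace Summit.HodgeConjecture.HodgeConjecture.Cruxes.HLiu418.K2LiuHermTwoEtaLineHolomorphy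

open Summit.HodgeConjecture.HodgeConjecture.Cruxes.HLiu418.K2LiuHermTwoGammaDefs
open Summit.HodgeConjecture.HodgeConjecture.Cruxes.HLiu418.K2LiuHermTwoConfluentXiDefs
open Summit.HodgeConjecture.HodgeConjecture.Cruxes.HLiu418.K2LiuHermTwoConfluentXiHolomorphy
open Summit.HodgeConjecture.HodgeConjecture.Cruxes.HLiu418.K2LiuHermTwoEtaDefs
open Summit.HodgeConjecture.HodgeConjecture.Cruxes.HLiu418.K2LiuHermTwoEtaConvergence
open Summit.HodgeConjecture.HodgeConjecture.Cruxes.HLiu418.K2LiuHermTwoXiEtaIdentity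
open Summit.HodgeConjecture.HodgeConjecture.Cruxes.HLiu418.K2LiuHermTwoEtaHolomorphy

/-! ## Three elementary real bounds -/

/-- For `δ ≤ p` and `a₁ ≤ a ≤ a₂`: `p^{a−2} ≤ max(1, δ^{a₁−a₂}) · p^{a₂−2}`. -/
theorem rpow_le_max_mul_rpow {δ p a a₁ a₂ : ℝ} (hδ : 0 < δ) (hp : δ ≤ p) (h₁ : a₁ ≤ a) (h₂ : a ≤ a₂) :
    p ^ (a - 2) ≤ max 1 (δ ^ (a₁ - a₂)) * p ^ (a₂ - 2) := by
  have hp0 : 0 < p := lt_of_lt_of_le hδ hp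
  rw [show a - 2 = (a - a₂) + (a₂ - 2) by ring, Real.rpow_add hp0]
  refine mul_le_mul_of_nonneg_right ?_ (Real.rpow_nonneg hp0.le _)
  rcases le_or_gt 1 p with hp1 | hp1
  · exact (Real.rpow_le_one_of_one_le_of_nonpos hp1 (by linarith)).trans (le_max_left _ _)
  · calc p ^ (a - a₂) ≤ δ ^ (a - a₂) := Real.rpow_le_rpow_of_nonpos hδ hp (by linarith)
      _ ≤ δ ^ (a₁ - a₂) := Real.rpow_le_rpow_of_exponent_ge hδ (by linarith) (by linarith)
      _ ≤ max 1 (δ ^ (a₁ - a₂)) := le_max_right _ _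

/-- For `δ ≤ p` (`δ > 0`): `|log p| ≤ (|log δ|/δ + 1) · p`. -/
theorem abs_log_le_mul_of_le {δ p : ℝ} (hδ : 0 < δ) (hp : δ ≤ p) : |Real.log p| ≤ (|Real.log δ| / δ + 1) * p := by
  have h := abs_log_le_of_le hδ hp one_pos
  rw [Real.rpow_one, div_one] at h
  have h2 : |Real.log δ| ≤ |Real.log δ| / δ * p := by
    rw [div_mul_eq_mul_div, le_div_iff₀ hδ]
    exact mul_le_mul_of_nonneg_left hp (abs_nonneg _)
  linarith

/-- For `q > 0`, `θ > 0`: `|log q| ≤ (q^θ + q^{−θ})/θ`. -/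
theorem abs_log_le_rpow_add_rpow_div {q θ : ℝ} (hq : 0 < q) (hθ : 0 < θ) : |Real.log q| ≤ (q ^ θ + q ^ (-θ)) / θ := by
  have h1 : Real.log q ≤ q ^ θ / θ := Real.log_le_rpow_div hq.le hθ
  have h2 : -Real.log q ≤ q ^ (-θ) / θ := by
    have := Real.log_le_rpow_div (inv_nonneg.mpr hq.le) hθ
    rwa [Real.log_inv, Real.inv_rpow hq.le, ← Real.rpow_neg hq.le] at this
  have h3 : 0 ≤ q ^ θ / θ := div_nonneg (Real.rpow_nonneg hq.le _) hθ.le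
  have h4 : 0 ≤ q ^ (-θ) / θ := div_nonneg (Real.rpow_nonneg hq.le _) hθ.le
  rw [abs_le, add_div]
  constructor <;> linarith

/-! ## The integrand along a complex line -/

/-- Along the line `(α, β) = (α₀ + u s, β₀ + v s)` the `η`-integrand factorises as `(η-integrand at (α₀, β₀)) · exp(s (u log det(x+h) + v log det(x−h)))`. -/
theorem etaTwoIntegrand_affine (g h : Matrix (Fin 2) (Fin 2) ℂ) {c : ℝ × ℂ × ℝ} (hP : (hermTwo c + h).det ≠ 0) (hQ : (hermTwo c - h).det ≠ 0)
    (α₀ β₀ u v s : ℂ) :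
    etaTwoIntegrand g h (α₀ + u * s) (β₀ + v * s) c = etaTwoIntegrand g h α₀ β₀ c *
      cexp (s * (u * Complex.log ((hermTwo c + h).det) + v * Complex.log ((hermTwo c - h).det))) := by
  rw [etaTwoIntegrand_apply, etaTwoIntegrand_apply, cpow_def_of_ne_zero hP, cpow_def_of_ne_zero hP, cpow_def_of_ne_zero hQ,
    cpow_def_of_ne_zero hQ]
  have h1 : cexp (Complex.log ((hermTwo c + h).det) * (α₀ + u * s - 2)) =
      cexp (Complex.log ((hermTwo c + h).det) * (α₀ - 2)) * cexp (s * (u * Complex.log ((hermTwo c + h).det))) := by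
    rw [← Complex.exp_add]
    congr 1
    ring
  have h2 : cexp (Complex.log ((hermTwo c - h).det) * (β₀ + v * s - 2)) =
      cexp (Complex.log ((hermTwo c - h).det) * (β₀ - 2)) * cexp (s * (v * Complex.log ((hermTwo c - h).det))) := by
    rw [← Complex.exp_add]
    congr 1
    ring
  rw [h1, h2, mul_add, Complex.exp_add]
  ring

/-- The `s`-derivative of the integrand along the line: `(u log det(x+h) + v log det(x−h)) ·` integrand. -/
theorem hasDerivAt_etaTwoIntegrand_affine (g h : Matrix (Fin 2) (Fin 2) ℂ) {c : ℝ × ℂ × ℝ} (hP : (hermTwo c + h).det ≠ 0)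
    (hQ : (hermTwo c - h).det ≠ 0) (α₀ β₀ u v s : ℂ) :
    HasDerivAt (fun s : ℂ => etaTwoIntegrand g h (α₀ + u * s) (β₀ + v * s) c)
      (etaTwoIntegrand g h (α₀ + u * s) (β₀ + v * s) c *
        (u * Complex.log ((hermTwo c + h).det) + v * Complex.log ((hermTwo c - h).det))) s := by
  have hfun : (fun s : ℂ => etaTwoIntegrand g h (α₀ + u * s) (β₀ + v * s) c) = fun s => etaTwoIntegrand g h α₀ β₀ c *
      cexp (s * (u * Complex.log ((hermTwo c + h).det) + v * Complex.log ((hermTwo c - h).det))) :=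
    funext fun s => etaTwoIntegrand_affine g h hP hQ α₀ β₀ u v s
  rw [hfun, etaTwoIntegrand_affine g h hP hQ α₀ β₀ u v s]
  have h1 : HasDerivAt (fun s : ℂ => cexp (s * (u * Complex.log ((hermTwo c + h).det) + v * Complex.log ((hermTwo c - h).det))))
      (cexp (s * (u * Complex.log ((hermTwo c + h).det) + v * Complex.log ((hermTwo c - h).det))) *
        (u * Complex.log ((hermTwo c + h).det) + v * Complex.log ((hermTwo c - h).det))) s :=
    (hasDerivAt_mul_const _).cexp
  exact (h1.const_mul (etaTwoIntegrand g h α₀ β₀ c)).congr_deriv (by ring)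

/-! ## Holomorphy of `η` along complex lines -/

/-- **DIFFERENTIATION UNDER THE INTEGRAL SIGN ALONG A LINE**: for `g, h > 0`, `α₀ β₀ u v : ℂ` and `re(β₀ + v s₀) > 1`, the function
`s ↦ η(g, h; α₀ + u s, β₀ + v s)` has at `s₀` the complex derivative `∫ (u log det(x+h) + v log det(x−h)) · (η-integrand) dx`. -/
theorem hasDerivAt_etaTwo_affine {g h : Matrix (Fin 2) (Fin 2) ℂ} (hg : g.PosDef) (hh : h.PosDef) (α₀ β₀ u v : ℂ) {s₀ : ℂ}
    (hs₀ : 1 < (β₀ + v * s₀).re) :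
    HasDerivAt (fun s : ℂ => etaTwo g h (α₀ + u * s) (β₀ + v * s))
      (∫ c in etaTwoSet h, etaTwoIntegrand g h (α₀ + u * s₀) (β₀ + v * s₀) c *
        (u * Complex.log ((hermTwo c + h).det) + v * Complex.log ((hermTwo c - h).det))) s₀ := by
  have hfun : (fun s : ℂ => etaTwo g h (α₀ + u * s) (β₀ + v * s)) =
      fun s => ∫ c in etaTwoSet h, etaTwoIntegrand g h (α₀ + u * s) (β₀ + v * s) c :=
    funext fun s => etaTwo_def g h _ _
  rw [hfun]
  obtain ⟨e, rfl⟩ : ∃ e : ℝ × ℂ × ℝ, hermTwo e = h := ⟨_, hermTwo_eq_of_isHermitian hh.1⟩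
  have h2e := (posDef_hermTwo_iff (e + e)).mp (by rw [hermTwo_add]; exact hh.add hh)
  set δ : ℝ := (e + e).1 * (e + e).2.2 - normSq (e + e).2.1 with hδdef
  have hδ : 0 < δ := by rw [hδdef]; linarith [h2e.2]
  -- the radius and the exponent ranges
  set a₀ : ℝ := (α₀ + u * s₀).re with ha₀
  set b₀ : ℝ := (β₀ + v * s₀).re with hb₀
  set ε : ℝ := (b₀ - 1) / (2 * (‖v‖ + 1)) with hε
  have hb₀1 : 0 < b₀ - 1 := by linarith
  have hεpos : 0 < ε := div_pos hb₀1 (by positivity)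
  have hvε : ‖v‖ * ε ≤ (b₀ - 1) / 2 := by
    rw [hε, show ‖v‖ * ((b₀ - 1) / (2 * (‖v‖ + 1))) = (b₀ - 1) / 2 * (‖v‖ / (‖v‖ + 1)) by field_simp]
    have h2 : ‖v‖ / (‖v‖ + 1) ≤ 1 := (div_le_one (by positivity)).mpr (by linarith)
    nlinarith
  set a₁ : ℝ := a₀ - ‖u‖ * ε with ha₁
  set a₂ : ℝ := a₀ + ‖u‖ * ε with ha₂
  set b₁ : ℝ := b₀ - ‖v‖ * ε with hb₁
  set b₂ : ℝ := b₀ + ‖v‖ * ε with hb₂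
  have hb₁1 : 1 < b₁ := by rw [hb₁]; linarith
  have hb₂1 : 1 < b₂ := by rw [hb₂]; nlinarith [norm_nonneg v]
  set θ : ℝ := (b₁ - 1) / 2 with hθ
  have hθpos : 0 < θ := by rw [hθ]; linarith
  set K₁ : ℝ := max 1 (δ ^ (a₁ - a₂)) with hK₁
  set K₂ : ℝ := |Real.log δ| / δ + 1 with hK₂
  have hK₁0 : 0 ≤ K₁ := le_trans zero_le_one (le_max_left _ _)
  have hK₂0 : 0 ≤ K₂ := by positivity
  -- the six integrable majorant pieces
  have hI1 := (integrableOn_etaTwoIntegrand_of_posDef hg hh ((a₂ + 1 : ℝ) : ℂ) (β := ((b₁ : ℝ) : ℂ)) (by simpa using hb₁1)).norm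
  have hI2 := (integrableOn_etaTwoIntegrand_of_posDef hg hh ((a₂ + 1 : ℝ) : ℂ) (β := ((b₂ : ℝ) : ℂ)) (by simpa using hb₂1)).norm
  have hI3 := (integrableOn_etaTwoIntegrand_of_posDef hg hh ((a₂ : ℝ) : ℂ) (β := ((b₁ + θ : ℝ) : ℂ))
    (by simp only [ofReal_re]; linarith)).norm
  have hI4 := (integrableOn_etaTwoIntegrand_of_posDef hg hh ((a₂ : ℝ) : ℂ) (β := ((b₁ - θ : ℝ) : ℂ))
    (by simp only [ofReal_re]; rw [hθ]; linarith)).norm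
  have hI5 := (integrableOn_etaTwoIntegrand_of_posDef hg hh ((a₂ : ℝ) : ℂ) (β := ((b₂ + θ : ℝ) : ℂ))
    (by simp only [ofReal_re]; linarith)).norm
  have hI6 := (integrableOn_etaTwoIntegrand_of_posDef hg hh ((a₂ : ℝ) : ℂ) (β := ((b₂ - θ : ℝ) : ℂ))
    (by simp only [ofReal_re]; rw [hθ]; nlinarith [norm_nonneg v])).norm
  refine (hasDerivAt_integral_of_dominated_loc_of_deriv_le (μ := (volume : Measure (ℝ × ℂ × ℝ)).restrict (etaTwoSet (hermTwo e)))
    (F := fun s c => etaTwoIntegrand g (hermTwo e) (α₀ + u * s) (β₀ + v * s) c)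
    (F' := fun s c => etaTwoIntegrand g (hermTwo e) (α₀ + u * s) (β₀ + v * s) c *
      (u * Complex.log ((hermTwo c + hermTwo e).det) + v * Complex.log ((hermTwo c - hermTwo e).det)))
    (bound := fun c => ‖u‖ * (K₁ * K₂) *
        (‖etaTwoIntegrand g (hermTwo e) ((a₂ + 1 : ℝ) : ℂ) ((b₁ : ℝ) : ℂ) c‖ + ‖etaTwoIntegrand g (hermTwo e) ((a₂ + 1 : ℝ) : ℂ) ((b₂ : ℝ) : ℂ) c‖) +
      ‖v‖ / θ * K₁ *
        (‖etaTwoIntegrand g (hermTwo e) ((a₂ : ℝ) : ℂ) ((b₁ + θ : ℝ) : ℂ) c‖ + ‖etaTwoIntegrand g (hermTwo e) ((a₂ : ℝ) : ℂ) ((b₁ - θ : ℝ) : ℂ) c‖ +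
          ‖etaTwoIntegrand g (hermTwo e) ((a₂ : ℝ) : ℂ) ((b₂ + θ : ℝ) : ℂ) c‖ + ‖etaTwoIntegrand g (hermTwo e) ((a₂ : ℝ) : ℂ) ((b₂ - θ : ℝ) : ℂ) c‖))
    (Metric.ball_mem_nhds s₀ hεpos) ?_ ?_ ?_ ?_ ?_ ?_).2
  · -- measurability of `F s`
    exact Filter.Eventually.of_forall fun s => aestronglyMeasurable_etaTwoIntegrand g (hermTwo e) _ _ _
  · -- integrability at `s₀`
    exact integrableOn_etaTwoIntegrand_of_posDef hg hh _ hs₀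
  · -- measurability of `F' s₀`
    exact ((measurable_etaTwoIntegrand g (hermTwo e) _ _).mul
      ((measurable_const.mul (Complex.measurable_log.comp (continuous_det_hermTwo_add (hermTwo e)).measurable)).add
        (measurable_const.mul (Complex.measurable_log.comp (continuous_det_hermTwo_sub (hermTwo e)).measurable)))).aestronglyMeasurable
  · -- THE DOMINATION on the ball, for `x` in the domain
    refine (ae_restrict_iff' (measurableSet_etaTwoSet hh.1)).mpr (Filter.Eventually.of_forall fun c hc s hs => ?_)
    have hsd : ‖s - s₀‖ < ε := by rw [← dist_eq_norm]; exact hs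
    obtain ⟨hcp, hcm⟩ := (mem_etaTwoSet_iff (hermTwo e) c).mp hc
    have hue := (posDef_hermTwo_iff (c - e)).mp (by rwa [hermTwo_sub])
    -- the two positive determinants
    set p : ℝ := (c + e).1 * (c + e).2.2 - normSq (c + e).2.1 with hpdef
    set q : ℝ := (c - e).1 * (c - e).2.2 - normSq (c - e).2.1 with hqdef
    have hδp : δ ≤ p := det_two_le_det_add hh hcm
    have hp : 0 < p := lt_of_lt_of_le hδ hδp
    have hq : 0 < q := by rw [hqdef]; linarith [hue.2]
    have hp' : (hermTwo c + hermTwo e).det = p := by rw [← hermTwo_add, det_hermTwo]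
    have hq' : (hermTwo c - hermTwo e).det = q := by rw [← hermTwo_sub, det_hermTwo]
    -- the exponents on the ball
    set a : ℝ := (α₀ + u * s).re with hadef
    set b : ℝ := (β₀ + v * s).re with hbdef
    have hare : a = a₀ + (u * (s - s₀)).re := by
      rw [hadef, ha₀]
      simp only [add_re, mul_re, sub_re, sub_im]
      ring
    have hbre : b = b₀ + (v * (s - s₀)).re := by
      rw [hbdef, hb₀]
      simp only [add_re, mul_re, sub_re, sub_im]
      ring
    have hua : |(u * (s - s₀)).re| ≤ ‖u‖ * ε :=
      (Complex.abs_re_le_norm _).trans (by rw [norm_mul]; exact mul_le_mul_of_nonneg_left hsd.le (norm_nonneg _))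
    have hvb : |(v * (s - s₀)).re| ≤ ‖v‖ * ε :=
      (Complex.abs_re_le_norm _).trans (by rw [norm_mul]; exact mul_le_mul_of_nonneg_left hsd.le (norm_nonneg _))
    have ha₁a : a₁ ≤ a := by rw [hare, ha₁]; linarith [(abs_le.mp hua).1]
    have haa₂ : a ≤ a₂ := by rw [hare, ha₂]; linarith [(abs_le.mp hua).2]
    have hb₁b : b₁ ≤ b := by rw [hbre, hb₁]; linarith [(abs_le.mp hvb).1]
    have hbb₂ : b ≤ b₂ := by rw [hbre, hb₂]; linarith [(abs_le.mp hvb).2]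
    -- the four elementary bounds
    have hpa : p ^ (a - 2) ≤ K₁ * p ^ (a₂ - 2) := rpow_le_max_mul_rpow hδ hδp ha₁a haa₂
    have hqb : q ^ (b - 2) ≤ q ^ (b₁ - 2) + q ^ (b₂ - 2) := by
      have h := Literature.Dynamics.TransferOperators.rpow_neg_le_add (a := 2 - b) (a₁ := 2 - b₂) (a₂ := 2 - b₁) hq
        (by linarith) (by linarith)
      rw [neg_sub, neg_sub, neg_sub] at h
      linarith
    have hLp : |Real.log p| ≤ K₂ * p := abs_log_le_mul_of_le hδ hδp
    have hLq : |Real.log q| ≤ (q ^ θ + q ^ (-θ)) / θ := abs_log_le_rpow_add_rpow_div hq hθpos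
    -- the coefficient
    have hcoef : ‖u * Complex.log ((hermTwo c + hermTwo e).det) + v * Complex.log ((hermTwo c - hermTwo e).det)‖ ≤
        ‖u‖ * |Real.log p| + ‖v‖ * |Real.log q| := by
      rw [hp', hq', ← Complex.ofReal_log hp.le, ← Complex.ofReal_log hq.le]
      refine (norm_add_le _ _).trans (le_of_eq ?_)
      rw [norm_mul, norm_mul, Complex.norm_real, Complex.norm_real, Real.norm_eq_abs, Real.norm_eq_abs]
    -- all `η`-norms in terms of `p`, `q`
    rw [norm_mul]
    simp only [norm_etaTwoIntegrand_eq hp hq hp' hq', Complex.ofReal_re]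
    rw [← hadef, ← hbdef]
    set P : ℝ := ‖cexp (-(hermTwo c * g).trace)‖ with hPdef
    have e1 : p ^ (a₂ + 1 - 2) = p ^ (a₂ - 2) * p := by
      rw [show a₂ + 1 - 2 = (a₂ - 2) + 1 by ring, Real.rpow_add_one hp.ne']
    have e3 : q ^ (b₁ + θ - 2) = q ^ (b₁ - 2) * q ^ θ := by
      rw [show b₁ + θ - 2 = (b₁ - 2) + θ by ring, Real.rpow_add hq]
    have e4 : q ^ (b₁ - θ - 2) = q ^ (b₁ - 2) * q ^ (-θ) := by
      rw [show b₁ - θ - 2 = (b₁ - 2) + (-θ) by ring, Real.rpow_add hq]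
    have e5 : q ^ (b₂ + θ - 2) = q ^ (b₂ - 2) * q ^ θ := by
      rw [show b₂ + θ - 2 = (b₂ - 2) + θ by ring, Real.rpow_add hq]
    have e6 : q ^ (b₂ - θ - 2) = q ^ (b₂ - 2) * q ^ (-θ) := by
      rw [show b₂ - θ - 2 = (b₂ - 2) + (-θ) by ring, Real.rpow_add hq]
    rw [e1, e3, e4, e5, e6]
    have hP0 : 0 ≤ P := norm_nonneg _
    calc P * (p ^ (a - 2) * q ^ (b - 2)) *
          ‖u * Complex.log ((hermTwo c + hermTwo e).det) + v * Complex.log ((hermTwo c - hermTwo e).det)‖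
        ≤ P * (p ^ (a - 2) * q ^ (b - 2)) * (‖u‖ * |Real.log p| + ‖v‖ * |Real.log q|) :=
          mul_le_mul_of_nonneg_left hcoef (by positivity)
      _ ≤ P * (K₁ * p ^ (a₂ - 2) * (q ^ (b₁ - 2) + q ^ (b₂ - 2))) * (‖u‖ * (K₂ * p) + ‖v‖ * ((q ^ θ + q ^ (-θ)) / θ)) := by
          gcongr
      _ = ‖u‖ * (K₁ * K₂) * (P * (p ^ (a₂ - 2) * p * q ^ (b₁ - 2)) + P * (p ^ (a₂ - 2) * p * q ^ (b₂ - 2))) +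
            ‖v‖ / θ * K₁ * (P * (p ^ (a₂ - 2) * (q ^ (b₁ - 2) * q ^ θ)) + P * (p ^ (a₂ - 2) * (q ^ (b₁ - 2) * q ^ (-θ))) +
              P * (p ^ (a₂ - 2) * (q ^ (b₂ - 2) * q ^ θ)) + P * (p ^ (a₂ - 2) * (q ^ (b₂ - 2) * q ^ (-θ)))) := by
          field_simp
          ring
  · -- integrability of the bound
    exact ((hI1.add hI2).const_mul _).add ((((hI3.add hI4).add hI5).add hI6).const_mul _)
  · -- the pointwise derivative, for `x` in the domain
    refine (ae_restrict_iff' (measurableSet_etaTwoSet hh.1)).mpr (Filter.Eventually.of_forall fun c hc s _ => ?_)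
    have hpq := det_pos_of_mem_etaTwoSet hc
    exact hasDerivAt_etaTwoIntegrand_affine g (hermTwo e) hpq.1.ne' hpq.2.ne' α₀ β₀ u v s

/-- **`η` IS HOLOMORPHIC ALONG COMPLEX LINES IN `(α, β)` where it converges**: for `g, h > 0` and `α₀ β₀ u v : ℂ`,
`s ↦ η(g, h; α₀ + u s, β₀ + v s)` is complex-differentiable on the open set `{s | 1 < re(β₀ + v s)}`. -/
theorem differentiableOn_etaTwo_affine {g h : Matrix (Fin 2) (Fin 2) ℂ} (hg : g.PosDef) (hh : h.PosDef) (α₀ β₀ u v : ℂ) :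
    DifferentiableOn ℂ (fun s : ℂ => etaTwo g h (α₀ + u * s) (β₀ + v * s)) {s : ℂ | 1 < (β₀ + v * s).re} :=
  fun _ hs => (hasDerivAt_etaTwo_affine hg hh α₀ β₀ u v hs).differentiableAt.differentiableWithinAt

/-- `β ↦ η(g, h; α, β)` is complex-differentiable at every `β` with `re β > 1` (`g, h > 0`, any `α`). -/
theorem differentiableAt_etaTwo_beta {g h : Matrix (Fin 2) (Fin 2) ℂ} (hg : g.PosDef) (hh : h.PosDef) (α : ℂ) {β : ℂ} (hβ : 1 < β.re) :
    DifferentiableAt ℂ (fun β : ℂ => etaTwo g h α β) β := by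
  have hd := (hasDerivAt_etaTwo_affine hg hh α 0 0 1 (s₀ := β) (by simpa using hβ)).differentiableAt
  have hf : (fun s : ℂ => etaTwo g h (α + 0 * s) (0 + 1 * s)) = fun s => etaTwo g h α s := by
    funext s
    rw [zero_mul, add_zero, one_mul, zero_add]
  rwa [hf] at hd

/-- THE DIAGONAL OF ROAD Φ: `s ↦ η(g, h; a + s, b + s)` is holomorphic on `{s | 1 < re(b + s)}` (`g, h > 0`). -/
theorem differentiableOn_etaTwo_diag {g h : Matrix (Fin 2) (Fin 2) ℂ} (hg : g.PosDef) (hh : h.PosDef) (a b : ℂ) :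
    DifferentiableOn ℂ (fun s : ℂ => etaTwo g h (a + s) (b + s)) {s : ℂ | 1 < (b + s).re} := by
  have h := differentiableOn_etaTwo_affine hg hh a b 1 1
  simp only [one_mul] at h
  exact h

/-- **THE CONTINUATION `Ξ` ALONG COMPLEX LINES**: for `g, h > 0`, `s ↦ Ξ(g, h; α₀ + u s, β₀ + v s) =
4π⁴ e^{iπ(β−α)} Γ₂(α)⁻¹ Γ₂(β)⁻¹ η(2g, πh; α, β)|_{(α,β) = (α₀+us, β₀+vs)}` is holomorphic on `{s | 1 < re(β₀ + v s)}`. -/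
theorem differentiableOn_xiEta_affine {g h : Matrix (Fin 2) (Fin 2) ℂ} (hg : g.PosDef) (hh : h.PosDef) (α₀ β₀ u v : ℂ) :
    DifferentiableOn ℂ (fun s : ℂ => ((4 * Real.pi ^ 4 : ℝ) : ℂ) * cexp ((Real.pi * I) * ((β₀ + v * s) - (α₀ + u * s))) *
      (hermTwoGamma (α₀ + u * s))⁻¹ * (hermTwoGamma (β₀ + v * s))⁻¹ * etaTwo ((2 : ℂ) • g) ((Real.pi : ℂ) • h) (α₀ + u * s) (β₀ + v * s))
      {s : ℂ | 1 < (β₀ + v * s).re} := by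
  have h2g : ((2 : ℂ) • g).PosDef := by
    rw [two_smul]
    exact hg.add hg
  obtain ⟨e, rfl⟩ : ∃ e : ℝ × ℂ × ℝ, hermTwo e = h := ⟨_, hermTwo_eq_of_isHermitian hh.1⟩
  have hπh : ((Real.pi : ℂ) • hermTwo e).PosDef := by
    rw [← hermTwo_smul]
    exact posDef_hermTwo_smul Real.pi_pos hh
  have hα : Differentiable ℂ (fun s : ℂ => α₀ + u * s) := (differentiable_id.const_mul u).const_add α₀
  have hβ : Differentiable ℂ (fun s : ℂ => β₀ + v * s) := (differentiable_id.const_mul v).const_add β₀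
  have hexp : Differentiable ℂ (fun s : ℂ => cexp ((Real.pi * I) * ((β₀ + v * s) - (α₀ + u * s)))) := ((hβ.sub hα).const_mul _).cexp
  have hΓα : Differentiable ℂ (fun s : ℂ => (hermTwoGamma (α₀ + u * s))⁻¹) := differentiable_hermTwoGamma_inv.comp hα
  have hΓβ : Differentiable ℂ (fun s : ℂ => (hermTwoGamma (β₀ + v * s))⁻¹) := differentiable_hermTwoGamma_inv.comp hβ
  exact (((((differentiable_const _).mul hexp).mul hΓα).mul hΓβ).differentiableOn).mul (differentiableOn_etaTwo_affine h2g hπh α₀ β₀ u v)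

end Summit.HodgeConjecture.HodgeConjecture.Cruxes.HLiu418.K2LiuHermTwoEtaLineHolomorphy

end
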